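import Summits.AtomisticToContinuum.HydrodynamicLimit.Theorems.BoxDissipativeWeakStrongRelativeEnergyStabilityTimeZeroHelpers
import Summits.AtomisticToContinuum.HydrodynamicLimit.Theorems.BoxDissipativeWeakStrongLocalGibbsFineScaleStaticsPrelim
import Summits.AtomisticToContinuum.HydrodynamicLimit.Theorems.BoxDissipativeWeakStrongEntropyAdmissibilityStubInitialEntropyLLN
import Literature.MathematicalPhysics.KineticTheory.HardSphereEulerProofs
import HarnessLib

/-!
# Crux `RelativeEnergyStability` (stmt-AtomisticToContinuum-17653), line `registered`:
stub `stub_clampedRelEnergyTimeZero` (S1')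

**S1' — the clamped box relative energy vanishes at `t = 0`.** In the line's currency
`E_{P_N} ofReal(∫ ℰ_{Z_{a,b}}(Û_N(t,x) | (ρ,u,θ)(t,x)) dx)` (`RES.BoxClampedRelEnergyVanishesAt`), the initial
value is `o(1)`: it is controlled by the `L¹(P_N ⊗ dx)` convergence of the box fields at `t = 0`
(`RES.BoxFieldsL1At … 0`, the conclusion of the crux's `LocalGibbsFineScale` antecedent). This is dominated
convergence with no Gibbs structure: the pointwise estimate of the helpers file
(`tz_pointwise_estimate`: `|ℰ_Z| ≤ ε + K'·dev` uniformly) integrates over the torus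
(`tz_integral_le`; the box fields of one configuration are bounded measurable in the centre `x`,
`tz_integrable_dev`, by the landed box-kernel lemma `EABirthS0b.integrable_boxKernel_left`), then against the
local Gibbs law, a probability measure for `σ ≤ 1/2` (`isProbabilityMeasure_localGibbsLaw`), giving
`E ofReal(∫ ℰ_Z) ≤ ofReal ε + ofReal K' · E ofReal(∫ dev dx)` (`tz_lintegral_le`, pointwise `lintegral_mono`, no
measurability in `z`), whose limsup is `≤ ofReal ε` for every `ε > 0` (`tz_tendsto_zero_of_le`).

References: BrezinaFeireisl2018 §3.1 (3.3)–(3.4); FeireislNovotny2012.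
-/

noncomputable section

namespace Summit.AtomisticToContinuum.HydrodynamicLimit.Theorems.RES

open MeasureTheory Filter Set
open scoped ENNReal Topology
open Summit.AtomisticToContinuum.HydrodynamicLimit.Theses.BoxDissipativeWeakStrong
open Literature.MathematicalPhysics.KineticTheory Literature.Analysis.FluidPDE
open Literature.Analysis.FluidPDE.CompressibleEuler
open Literature.Analysis.FluidPDE.CompressibleEuler.EulerPhase

/-! ## Integrability of the box fields in the centre variable -/

/-- The deviation of the box fields of one configuration from continuous reference fields is
integrable in the centre `x`. -/
theorem tz_integrable_dev {n : ℕ} (w : Config n (Fin 3) T3) {l : ℝ} (hl : 0 ≤ l)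
    {f₁ f₃ : T3 → ℝ} {f₂ : T3 → V3} (h₁ : Continuous f₁) (h₂ : Continuous f₂) (h₃ : Continuous f₃) :
    Integrable fun x : T3 =>
      |empiricalDensityField w (boxKernel l x) - f₁ x| +
        ‖empiricalMomentumField w (boxKernel l x) - f₂ x‖ +
        |empiricalEnergyField w (boxKernel l x) - f₃ x| := by
  have hK : ∀ i : Fin n, Integrable fun x : T3 => boxKernel l x (w i).1 := fun i =>
    EABirthS0b.integrable_boxKernel_left hl (w i).1
  have hD : Integrable fun x : T3 => empiricalDensityField w (boxKernel l x) := by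
    simp_rw [empiricalDensityField_eq_sum]
    exact (integrable_finsetSum _ fun i _ => hK i).const_mul _
  have hM : Integrable fun x : T3 => empiricalMomentumField w (boxKernel l x) := by
    simp_rw [empiricalMomentumField_eq_sum]
    exact (integrable_finsetSum _ fun i _ => (hK i).smul_const ((w i).2)).smul ((n : ℝ)⁻¹)
  have hE : Integrable fun x : T3 => empiricalEnergyField w (boxKernel l x) := by
    simp_rw [empiricalEnergyField_eq_sum]
    exact (integrable_finsetSum _ fun i _ => (hK i).mul_const _).const_mul _
  have c₁ : Integrable f₁ := h₁.integrable_of_hasCompactSupport (HasCompactSupport.of_compactSpace _)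
  have c₂ : Integrable f₂ := h₂.integrable_of_hasCompactSupport (HasCompactSupport.of_compactSpace _)
  have c₃ : Integrable f₃ := h₃.integrable_of_hasCompactSupport (HasCompactSupport.of_compactSpace _)
  exact ((hD.sub c₁).abs.add (hM.sub c₂).norm).add (hE.sub c₃).abs

/-! ## An `ℝ≥0∞` squeeze -/

/-- If `f_N ≤ ε + K_ε A_N` for every `ε > 0` with `K_ε < ∞` and `A_N → 0`, then `f_N → 0`. -/
theorem tz_tendsto_zero_of_le {f A : ℕ → ℝ≥0∞} (hA : Tendsto A atTop (𝓝 0))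
    (h : ∀ ε : ℝ, 0 < ε → ∃ K : ℝ≥0∞, K ≠ ∞ ∧ ∀ N, f N ≤ ENNReal.ofReal ε + K * A N) :
    Tendsto f atTop (𝓝 0) := by
  rw [ENNReal.tendsto_atTop_zero]
  intro ε hε
  by_cases htop : ε = ∞
  · exact ⟨0, fun n _ => htop ▸ le_top⟩
  have he : 0 < ε.toReal := ENNReal.toReal_pos hε.ne' htop
  obtain ⟨K, hK, hf⟩ := h (ε.toReal / 2) (half_pos he)
  have hKA : Tendsto (fun N => K * A N) atTop (𝓝 0) := by
    simpa using ENNReal.Tendsto.const_mul hA (Or.inr hK)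
  obtain ⟨N₀, hN₀⟩ := ENNReal.tendsto_atTop_zero.1 hKA (ENNReal.ofReal (ε.toReal / 2))
    (by simpa using half_pos he)
  refine ⟨N₀, fun n hn => (hf n).trans ?_⟩
  calc ENNReal.ofReal (ε.toReal / 2) + K * A n
      ≤ ENNReal.ofReal (ε.toReal / 2) + ENNReal.ofReal (ε.toReal / 2) := add_le_add le_rfl (hN₀ n hn)
    _ = ε := by
        rw [← ENNReal.ofReal_add (half_pos he).le (half_pos he).le, add_halves, ENNReal.ofReal_toReal htop]

/-! ## Integration in the centre variable -/

/-- **Integrating the pointwise estimate over the torus**: `∫ ℰ_Z dx ≤ ε + K' ∫ dev dx`. -/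
theorem tz_integral_le {n : ℕ} (w : Config n (Fin 3) T3) {l : ℝ} (hl : 0 ≤ l) {σ η₁ a b ε K' : ℝ}
    {ρ₀ θ₀ : T3 → ℝ} {u₀ : T3 → V3} (hρ : Continuous ρ₀) (hu : Continuous u₀) (hθ : Continuous θ₀)
    (hpt : ∀ (x : T3) (U : BoxState), |clampedRelEnergy σ η₁ a b (ρ₀ x) (u₀ x) (θ₀ x) U| ≤
      ε + K' * (|U.1 - ρ₀ x| + ‖U.2.1 - ρ₀ x • u₀ x‖ +
        |U.2.2 - totalEnergyDensity (ρ₀ x) (u₀ x) (θ₀ x)|)) :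
    ∫ x, clampedRelEnergy σ η₁ a b (ρ₀ x) (u₀ x) (θ₀ x) (boxState l w x) ≤
      ε + K' * ∫ x, (|empiricalDensityField w (boxKernel l x) - ρ₀ x| +
        ‖empiricalMomentumField w (boxKernel l x) - ρ₀ x • u₀ x‖ +
        |empiricalEnergyField w (boxKernel l x) - totalEnergyDensity (ρ₀ x) (u₀ x) (θ₀ x)|) := by
  have hE : Continuous fun x => totalEnergyDensity (ρ₀ x) (u₀ x) (θ₀ x) := by
    unfold totalEnergyDensity; fun_prop
  have hint := tz_integrable_dev w hl (f₂ := fun x => ρ₀ x • u₀ x) hρ (hρ.smul hu) hE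
  calc ∫ x, clampedRelEnergy σ η₁ a b (ρ₀ x) (u₀ x) (θ₀ x) (boxState l w x)
      ≤ |∫ x, clampedRelEnergy σ η₁ a b (ρ₀ x) (u₀ x) (θ₀ x) (boxState l w x)| := le_abs_self _
    _ ≤ ∫ x, |clampedRelEnergy σ η₁ a b (ρ₀ x) (u₀ x) (θ₀ x) (boxState l w x)| :=
        abs_integral_le_integral_abs
    _ ≤ ∫ x, (ε + K' * (|empiricalDensityField w (boxKernel l x) - ρ₀ x| +
          ‖empiricalMomentumField w (boxKernel l x) - ρ₀ x • u₀ x‖ +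
          |empiricalEnergyField w (boxKernel l x) - totalEnergyDensity (ρ₀ x) (u₀ x) (θ₀ x)|)) :=
        integral_mono_of_nonneg (ae_of_all _ fun x => abs_nonneg _)
          ((integrable_const ε).add (hint.const_mul K')) (ae_of_all _ fun x => hpt x (boxState l w x))
    _ = ε + K' * ∫ x, (|empiricalDensityField w (boxKernel l x) - ρ₀ x| +
          ‖empiricalMomentumField w (boxKernel l x) - ρ₀ x • u₀ x‖ +
          |empiricalEnergyField w (boxKernel l x) - totalEnergyDensity (ρ₀ x) (u₀ x) (θ₀ x)|) := by
        rw [integral_add (integrable_const ε) (hint.const_mul K'), integral_const, integral_const_mul]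
        simp

/-! ## Expectation against a probability law -/

/-- **Averaging the pathwise estimate**: `obs ≤ ε + K' D` pointwise with `ε, K', D ≥ 0` gives
`E ofReal(obs) ≤ ofReal ε + ofReal K' · E ofReal(D)` under a probability law (no measurability needed). -/
theorem tz_lintegral_le {Ω : Type*} [MeasurableSpace Ω] (P : Measure Ω) [IsProbabilityMeasure P]
    {obs D : Ω → ℝ} {ε K' : ℝ} (hε : 0 ≤ ε) (hK' : 0 ≤ K') (hD : ∀ z, 0 ≤ D z)
    (h : ∀ z, obs z ≤ ε + K' * D z) :
    ∫⁻ z, ENNReal.ofReal (obs z) ∂P ≤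
      ENNReal.ofReal ε + ENNReal.ofReal K' * ∫⁻ z, ENNReal.ofReal (D z) ∂P := by
  calc ∫⁻ z, ENNReal.ofReal (obs z) ∂P
      ≤ ∫⁻ z, (ENNReal.ofReal ε + ENNReal.ofReal K' * ENNReal.ofReal (D z)) ∂P :=
        lintegral_mono fun z => by
          rw [← ENNReal.ofReal_mul hK', ← ENNReal.ofReal_add hε (mul_nonneg hK' (hD z))]
          exact ENNReal.ofReal_le_ofReal (h z)
    _ = ENNReal.ofReal ε + ENNReal.ofReal K' * ∫⁻ z, ENNReal.ofReal (D z) ∂P := by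
        rw [lintegral_add_left measurable_const, lintegral_const, measure_univ, mul_one,
          lintegral_const_mul' _ _ ENNReal.ofReal_ne_top]

/-! ## The stub -/

/-- **S1' — the clamped box relative energy vanishes at `t = 0` (size M⁻; dominated convergence, no
Gibbs structure).** Under `HsEosLowDensity` (threshold `ηa := η₀`), for a band `η₁ < ηa`, continuous
profiles, `0 < σ ≤ 1/2` (so that the local Gibbs laws are probability measures), a classical hard-sphere Euler
solution on `[0,T)`, `0 < T`, flows, a kinetic window and clamps admissible at `τ = 0`, the `L¹(P_N ⊗ dx)`
convergence of the box fields at `t = 0` forces `E_{P_N} ofReal(∫ ℰ_{Z_{a,b}}(Û_N(0,x) | (ρ,u,θ)(0,x)) dx) → 0`: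
the pointwise estimate `tz_pointwise_estimate` integrates in `x` to `∫ ℰ_Z dx ≤ ε + K' ∫ dev dx` pathwise
(`tz_integral_le`), hence `E ofReal(∫ ℰ_Z) ≤ ofReal ε + ofReal K' · E ofReal(∫ dev) → ofReal ε`
(`tz_lintegral_le`), `ε` arbitrary (`tz_tendsto_zero_of_le`). -/
theorem stub_clampedRelEnergyTimeZero :
    HsEosLowDensity →
      ∃ ηa : ℝ, 0 < ηa ∧ ∀ η₁ : ℝ, 0 < η₁ → η₁ < ηa →
        ∀ (a₀ θ₀ : T3 → ℝ) (u₀ : T3 → V3), Continuous a₀ → Continuous θ₀ → Continuous u₀ →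
          (∀ x, 0 < a₀ x) → (∀ x, 0 < θ₀ x) →
          ∀ σ : ℝ, 0 < σ → σ ≤ 1 / 2 →
            ∀ (T : ℝ) (ρ θ : ℝ → T3 → ℝ) (u : ℝ → T3 → V3), IsHardSphereEulerSolution σ T ρ u θ → 0 < T →
              ∀ Φ : (N : ℕ) → HardSphereFlow (Literature.Analysis.FluidPDE.Torus.geometry (Fin 3))
                  (hsDiameter σ N) (N + 1),
                ∀ ℓ : ℕ → ℝ, IsKineticWindow ℓ →
                  ∀ a b : ℝ, ClampAdmissible σ η₁ a b ρ θ 0 →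
                    BoxFieldsL1At σ a₀ u₀ θ₀ Φ ρ u θ ℓ 0 →
                      BoxClampedRelEnergyVanishesAt σ η₁ a b a₀ u₀ θ₀ Φ ρ u θ ℓ 0 := by
  intro hEos
  obtain ⟨ηa, hηa, hpw⟩ := tz_pointwise_estimate hEos
  refine ⟨ηa, hηa, ?_⟩
  intro η₁ hη₁ hη₁a a₀ θ₀ u₀ ha hθ hu ha0 hθ0 σ hσ hσ2 T ρ θ u hsol hT Φ ℓ hℓ a b hadm hL1
  have h0T : (0 : ℝ) ∈ Ico 0 T := ⟨le_rfl, hT⟩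
  have hρc : Continuous (ρ 0) := (hsol.smooth_density.isSmooth_slice h0T).continuous
  have huc : Continuous (u 0) := (hsol.smooth_velocity.isSmooth_slice h0T).continuous
  have hθc : Continuous (θ 0) := (hsol.smooth_temperature.isSmooth_slice h0T).continuous
  refine tz_tendsto_zero_of_le hL1 fun ε hε => ?_
  obtain ⟨K', hK'0, hpt⟩ := hpw η₁ hη₁ hη₁a σ hσ T ρ θ u hsol hT a b hadm ε hε
  refine ⟨ENNReal.ofReal K', ENNReal.ofReal_ne_top, fun N => ?_⟩
  haveI := isProbabilityMeasure_localGibbsLaw ha hθ hu ha0 hθ0 hσ2 N (Φ N)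
  refine tz_lintegral_le _ hε.le hK'0 (fun z => integral_nonneg fun x => by positivity) fun z => ?_
  exact tz_integral_le ((Φ N).flow 0 z) (hℓ.1 N).1.le hρc huc hθc hpt

end Summit.AtomisticToContinuum.HydrodynamicLimit.Theorems.RES

end
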